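import Mathlib
import Literature.NumberTheory.LFunctions.Zhang2022.Section17NuOneStarExpansion
import Literature.NumberTheory.LFunctions.Zhang2022.Section17NuStarSizes
import Literature.NumberTheory.LFunctions.Zhang2022.Section17U021ChiR1Prelims
import HarnessLib

/-!
# Zhang (2022) §17.u014/u021: `ν₁*` as a COMPLETE convolution minus its `D⁴`-tail, and `|υ| ≤ ν²`

Topic `Literature/NumberTheory/LFunctions/Zhang2022` (Landau–Siegel audit tree; verdict-neutral).
Y. Zhang, *Discrete mean estimates and the Landau–Siegel zero*, arXiv:2211.02515v1 (2022)
[Zhang2022LandauSiegel] — **an unrefereed manuscript under adjudication**; nothing here asserts or denies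
its Theorems 1–2. §17 p. 97 (u014: `G(s)N(s+β₂)N(s+β₃) = Σ ν₁*(l)ψ(l)l^{−s}`,
`ν₁* = υ·[≤D⁴] ∗ nN_{β₂} ∗ nN_{β₃}`) and §3 p. 6 (`υ = μ ∗ μχ`, `ν = 1 ∗ χ`). Tools for the §17.u021
remainder `R₁` in the χ-reading (WP16 leaf h17_9; the lane's R₁ route, R1-ANALYSIS §9 / MEMO-R1-window
P1): the `G`-truncation `a ≤ D⁴` inside `ν₁*` is the COMPLETE Dirichlet convolution `υ ∗ W`
(`W = nN_{β₂} ∗ nN_{β₃}`) minus the tail over divisors `a > D⁴` (tree identity, `Section17U021ChiR1Prelims`),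
and the tail is majorised by `ν(a)²τ₂` — the shape on which the tree's Lemma 3.1 / Lemma 3.2♭ (long range,
`Lemma32Flat.lemma_3_2_flat_long`) act under (A):

* `ups_prime_pow_succ` — `υ(p) = −(1+χ(p))`, `υ(p²) = χ(p)`, `υ(p^k) = 0` (`k ≥ 3`);
* `norm_ups_le_norm_nu_sq` — **`|υ(n)| ≤ |ν(n)|²`** for a real `χ` (prime powers: `|1+χ(p)| ≤ (1+χ(p))²`,
  `|χ(p)| ≤ ν(p²)²`; both sides multiplicative);
* `norm_nuOneStar_tail_le(_tau)`, `norm_nuOneStar_sub_conv_le` — with the tree's identity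
  `ν₁*(n) = (υ ∗ W)(n) − Σ_{k∣n, k>D⁴} υ(k)W(n/k)` (`Typed.Section17.nuOneStar_eq_conv_sub_tail`,
  `Section17U021ChiR1Prelims`): `‖ν₁*(n) − (υ∗W)(n)‖ ≤ Σ_{k∣n, k>D⁴} |ν(k)|²τ₂(n/k)`.

Theorems only (no definitions, no named facts); axioms standard. WHAT THIS IS NOT: a bound for `R₁`;
any claim about Theorems 1–2 of the source or about Landau–Siegel zeros.

## References

* Y. Zhang, arXiv:2211.02515v1 (2022), §3 p. 6, §17 p. 97 (u014), p. 98 (u021).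
  [cite: Zhang2022LandauSiegel, §17 u014 p.97]
-/

noncomputable section

open Complex Finset ArithmeticFunction
open Literature.NumberTheory.LFunctions.Zhang2022.Skeleton
open Literature.NumberTheory.LFunctions.Zhang2022.Typed.Section17

namespace Literature.NumberTheory.LFunctions.Zhang2022.Phi3Eval

variable {D : ℕ} (χ : DirichletCharacter ℂ D)

/-! ## §1. `υ` at prime powers and `|υ| ≤ ν²` -/

/-- `υ(n)` agrees with the arithmetic function `μ ∗ μχ` for `n ≠ 0`. [cite: Zhang2022LandauSiegel, §3 p.6] -/
theorem ups_eq_toAF_apply {n : ℕ} (hn : n ≠ 0) :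
    ups χ n = ((ArithmeticFunction.moebius : ArithmeticFunction ℂ) *
      toArithmeticFunction (fun k : ℕ => (ArithmeticFunction.moebius k : ℂ) * χ (k : ZMod D))) n := by
  rw [← toAF_ups_eq χ]; simp [toArithmeticFunction, hn]

/-- The arithmetic function `μχ` is multiplicative. [cite: Zhang2022LandauSiegel, §3 p.6] -/
theorem isMultiplicative_moebiusChiAF :
    (toArithmeticFunction (fun k : ℕ => (ArithmeticFunction.moebius k : ℂ) * χ (k : ZMod D))).IsMultiplicative := by
  refine ⟨by simp [toArithmeticFunction], fun {m n} hmn => ?_⟩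
  rcases Nat.eq_zero_or_pos m with rfl | hm
  · simp [toArithmeticFunction]
  rcases Nat.eq_zero_or_pos n with rfl | hn
  · simp [toArithmeticFunction]
  simp only [toArithmeticFunction, ArithmeticFunction.coe_mk, hm.ne', hn.ne', (mul_ne_zero hm.ne' hn.ne'),
    if_false]
  rw [ArithmeticFunction.isMultiplicative_moebius.map_mul_of_coprime hmn, Nat.cast_mul, map_mul]
  push_cast
  ring

/-- `υ` is multiplicative on coprime arguments. [cite: Zhang2022LandauSiegel, §3 p.6] -/
theorem ups_mul_of_coprime {m n : ℕ} (hm : m ≠ 0) (hn : n ≠ 0) (hmn : Nat.Coprime m n) :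
    ups χ (m * n) = ups χ m * ups χ n := by
  rw [ups_eq_toAF_apply χ (mul_ne_zero hm hn), ups_eq_toAF_apply χ hm, ups_eq_toAF_apply χ hn]
  exact (ArithmeticFunction.isMultiplicative_moebius.intCast.mul
    (isMultiplicative_moebiusChiAF χ)).map_mul_of_coprime hmn

/-- `υ(1) = 1`. [cite: Zhang2022LandauSiegel, §3 p.6] -/
theorem ups_one : ups χ 1 = 1 := by
  rw [ups_eq_toAF_apply χ one_ne_zero]
  exact (ArithmeticFunction.isMultiplicative_moebius.intCast.mul (isMultiplicative_moebiusChiAF χ)).map_one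

/-- **`υ` at prime powers**: `υ(p^{k+1}) = (μχ)(p^{k+1}) − (μχ)(p^k)`, i.e. `υ(p) = −(1+χ(p))`,
`υ(p²) = χ(p)`, `υ(p^k) = 0` for `k ≥ 3`. [cite: Zhang2022LandauSiegel, §3 p.6] -/
theorem ups_prime_pow_succ {p : ℕ} (hp : p.Prime) (k : ℕ) :
    ups χ (p ^ (k + 1)) = if k = 0 then -(1 + χ (p : ZMod D)) else if k = 1 then χ (p : ZMod D) else 0 := by
  have hp0 : p ≠ 0 := hp.ne_zero
  set M := toArithmeticFunction (fun k : ℕ => (ArithmeticFunction.moebius k : ℂ) * χ (k : ZMod D)) with hM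
  have hMval : ∀ j : ℕ, M (p ^ j) = if j = 0 then 1 else if j = 1 then -χ (p : ZMod D) else 0 := by
    intro j
    simp only [hM, toArithmeticFunction, ArithmeticFunction.coe_mk, pow_ne_zero j hp0, if_false]
    rcases j with _ | j
    · simp
    · rw [ArithmeticFunction.moebius_apply_prime_pow hp (Nat.succ_ne_zero j)]
      rcases j with _ | j
      · simp
      · simp
  rw [ups_eq_toAF_apply χ (pow_ne_zero _ hp0), ← hM, RankinEisenstein.mul_apply_prime_pow _ _ hp,
    Finset.sum_range_succ, Finset.sum_range_succ]
  have hzero : ∑ i ∈ Finset.range k, ((ArithmeticFunction.moebius : ArithmeticFunction ℂ)) (p ^ i) *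
      M (p ^ (k + 1 - i)) = 0 := by
    refine Finset.sum_eq_zero fun i hi => ?_
    have hi' : i < k := Finset.mem_range.1 hi
    rw [hMval, if_neg (by omega), if_neg (by omega), mul_zero]
  rw [hzero, zero_add, show k + 1 - k = 1 by omega, Nat.sub_self, intCoe_apply, intCoe_apply, hMval, hMval]
  simp only [one_ne_zero, if_false, if_true]
  rcases k with _ | k
  · rw [pow_zero, ArithmeticFunction.moebius_apply_one, pow_one, ArithmeticFunction.moebius_apply_prime hp]
    simp
  · have hμa : ((ArithmeticFunction.moebius (p ^ (k + 1 + 1)) : ℤ) : ℂ) = 0 := by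
      rw [ArithmeticFunction.moebius_apply_prime_pow hp (by omega), if_neg (by omega)]; simp
    have hμb : ((ArithmeticFunction.moebius (p ^ (k + 1)) : ℤ) : ℂ) = if k = 0 then -1 else 0 := by
      rw [ArithmeticFunction.moebius_apply_prime_pow hp (by omega)]
      rcases k with _ | k
      · simp
      · rw [if_neg (by omega), if_neg (by omega)]; simp
    rw [hμa, hμb]
    rcases k with _ | k
    · simp
    · rw [if_neg (by omega), if_neg (by omega), if_neg (by omega)]; simp

/-- **`|υ(n)| ≤ |ν(n)|²`** for a real character (`ν = 1 ∗ χ ∈ ℕ`; at prime powers `|1+χ(p)| ≤ (1+χ(p))²`,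
`|χ(p)| ≤ ν(p²)²`, `0 ≤ ν²`; both sides multiplicative). [cite: Zhang2022LandauSiegel, §3 p.6] -/
theorem norm_ups_le_norm_nu_sq (hq : χ.IsQuadratic) (n : ℕ) : ‖ups χ n‖ ≤ ‖nu χ n‖ ^ 2 := by
  induction n using Nat.recOnPosPrimePosCoprime with
  | zero => simp [ups, LSeries.convolution]
  | one => rw [ups_one, nu, divisorSumChar_one]; simp
  | prime_pow p k hp hk =>
    obtain ⟨k, rfl⟩ := Nat.exists_eq_succ_of_ne_zero hk.ne'
    rw [ups_prime_pow_succ χ hp k, nu, divisorSumChar_prime_pow χ hp, geomPartialSum]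
    rcases hq (p : ZMod D) with h | h | h <;> rw [h]
    · -- χ(p) = 0
      split_ifs <;> simp [Finset.sum_range_succ']
    · -- χ(p) = 1
      rcases k with _ | _ | k
      · norm_num [Finset.sum_range_succ]
      · norm_num [Finset.sum_range_succ]
      · simp
    · -- χ(p) = -1
      rcases k with _ | _ | k
      · simp
      · norm_num [Finset.sum_range_succ]
      · simp
  | coprime a b ha hb hab iha ihb =>
    rw [ups_mul_of_coprime χ (by omega) (by omega) hab, nu, divisorSumChar_mul_of_coprime χ hab, norm_mul,
      norm_mul, mul_pow]
    exact mul_le_mul iha ihb (norm_nonneg _) (by positivity)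

/-! ## §2. The `D⁴`-tail of `ν₁*` is majorised by `ν²` -/

/-- **The tail is majorised by `ν²`**: with `W = nN_{β₂} ∗ nN_{β₃}` and the tree's identity
`ν₁*(n) = (υ ∗ W)(n) − Σ_{k∣n, k>D⁴} υ(k)W(n/k)` (`Typed.Section17.nuOneStar_eq_conv_sub_tail`,
`Section17U021ChiR1Prelims`): `‖Σ_{k∣n, k>D⁴} υ(k)W(n/k)‖ ≤ Σ_{k∣n, k>D⁴} |ν(k)|²‖W(n/k)‖`
(`|υ| ≤ ν²`). Under (A) these tails are negligible on average by the tree's Lemma 3.1 / Lemma 3.2♭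
(long range, `Lemma32Flat.lemma_3_2_flat_long`), since `k > D⁴`. [cite: Zhang2022LandauSiegel, §17 u021 p.98] -/
theorem norm_nuOneStar_tail_le (hq : χ.IsQuadratic) (c' : ℝ) (n : ℕ) :
    ‖∑ k ∈ n.divisors with D ^ 4 < k,
        ups χ k * LSeries.convolution (nN D (beta2 c' D)) (nN D (beta3 c' D)) (n / k)‖ ≤
      ∑ k ∈ n.divisors with D ^ 4 < k,
        ‖nu χ k‖ ^ 2 * ‖LSeries.convolution (nN D (beta2 c' D)) (nN D (beta3 c' D)) (n / k)‖ := by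
  refine (norm_sum_le _ _).trans (Finset.sum_le_sum fun k _ => ?_)
  rw [norm_mul]
  exact mul_le_mul_of_nonneg_right (norm_ups_le_norm_nu_sq χ hq k) (norm_nonneg _)

/-- `‖(nN_{β₂} ∗ nN_{β₃})(b)‖ ≤ τ₂(b)` (`|nN| ≤ 1` for `𝓛 > 0`, the shifts being purely imaginary).
[cite: Zhang2022LandauSiegel, §17 u014 p.97] -/
theorem norm_conv_nN_nN_le_tau (c' : ℝ) (hℓ : 0 < ell D) (b : ℕ) :
    ‖LSeries.convolution (nN D (beta2 c' D)) (nN D (beta3 c' D)) b‖ ≤ MeanSquareMajorant.tau 2 b := by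
  have h2 : (beta2 c' D).re = 0 := by simp [beta2]
  have h3 : (beta3 c' D).re = 0 := by simp [beta3]
  rw [LSeries.convolution_def, ← card_antidiag_eq_tau_two]
  refine (norm_sum_le _ _).trans (Finset.sum_le_sum fun x _ => ?_)
  rw [norm_mul]
  exact mul_le_one₀ (Phi3TermByTerm.norm_nN_le_one hℓ h2 _) (norm_nonneg _)
    (Phi3TermByTerm.norm_nN_le_one hℓ h3 _)

/-- The tail with the crude `‖W‖ ≤ τ₂`: `‖Σ_{k∣n, k>D⁴} υ(k)W(n/k)‖ ≤ Σ_{k∣n, k>D⁴} |ν(k)|²τ₂(n/k)` — the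
shape on which `lemma_3_1` / `lemma_3_2_flat_long` act after summation over `n`.
[cite: Zhang2022LandauSiegel, §17 u021 p.98] -/
theorem norm_nuOneStar_tail_le_tau (hq : χ.IsQuadratic) (c' : ℝ) (hℓ : 0 < ell D) (n : ℕ) :
    ‖∑ k ∈ n.divisors with D ^ 4 < k,
        ups χ k * LSeries.convolution (nN D (beta2 c' D)) (nN D (beta3 c' D)) (n / k)‖ ≤
      ∑ k ∈ n.divisors with D ^ 4 < k, ‖nu χ k‖ ^ 2 * MeanSquareMajorant.tau 2 (n / k) := by
  refine (norm_nuOneStar_tail_le χ hq c' n).trans (Finset.sum_le_sum fun k _ => ?_)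
  exact mul_le_mul_of_nonneg_left (norm_conv_nN_nN_le_tau c' hℓ _) (by positivity)

/-- **`ν₁*` versus the complete convolution, in norm**: for a real `χ` and `𝓛 > 0`,
`‖ν₁*(n) − (υ ∗ W)(n)‖ ≤ Σ_{k∣n, k>D⁴} |ν(k)|²τ₂(n/k)`. [cite: Zhang2022LandauSiegel, §17 u021 p.98] -/
theorem norm_nuOneStar_sub_conv_le (hq : χ.IsQuadratic) (c' : ℝ) (hℓ : 0 < ell D) (n : ℕ) :
    ‖nuOneStar c' χ n -
        LSeries.convolution (ups χ) (LSeries.convolution (nN D (beta2 c' D)) (nN D (beta3 c' D))) n‖ ≤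
      ∑ k ∈ n.divisors with D ^ 4 < k, ‖nu χ k‖ ^ 2 * MeanSquareMajorant.tau 2 (n / k) := by
  rw [Typed.Section17.nuOneStar_eq_conv_sub_tail c' χ n, sub_sub_cancel_left, norm_neg]
  exact norm_nuOneStar_tail_le_tau χ hq c' hℓ n

end Literature.NumberTheory.LFunctions.Zhang2022.Phi3Eval
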